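import Summits.Ventures.CertifiedManyBodySolver.Theorems.TcThermcert1TrialGeneratorSockets
import Summits.Ventures.CertifiedManyBodySolver.Theorems.TcThermcert1VertexStubTrialGeneratorHook
import Summits.Ventures.CertifiedManyBodySolver.Theorems.TcThermcert1VertexLagrAffine
import Summits.Ventures.CertifiedManyBodySolver.Theses.TcThermcert1
import HarnessLib

/-!
# Route «hubbard-tc-thermcert-1», crux K2 `TcThermcert1.ThermalStiffnessCeilingBoxb10_le_9o71` (stmt-Ventures-26382), line «vertex»:
# the sorry-free COMPOSITION over the tree objects — the crux K2 follows from the ONE open stub statement `VertexCoverBoxB10`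

HONEST FRAMING: a one-sided CEILING chain under a hypothesis; the hypothesis `VertexCoverBoxB10` (stub S4 of line «vertex», a finite
cover of the banded supporting set by `(U, μ₀)`-cells with four frozen-dual corner certificates each) is NOT proved anywhere today — it is
the crux content and the producers' object; so nothing about the Hubbard model is proved unconditionally in this file; no certificate, no
number, no `T_c`; KT ceilings never assert superconductivity; NO lower bound on `T_c` is claimed; no summit, rung or crux statement is
proved here. Cell `pub/hubbard-tc` (MO-S3 × D-0154 (1) thermcert-1), seat `hubbard-tc-p1` (g28), offer (c1) to the cell lead.

This is §5 of the REGISTERED skeleton of line «vertex» (hub-tc-therm-plan-2, `Cruxes/ThermalStiffnessCeilingBoxb10_le_9o71/Lines/vertex.lean`,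
sha16 135a6fd895490092), VERBATIM over the landed objects — `Theorems/TcThermcert1Defs.lean` (hubbard-thermal-p4, p614173: `trialWord`,
`IsTrialGenerator`, `InMuBand`, `IsThermalRowState`, `TrialGeneratorHook`, `IsSupportingMu`), `Theorems/TcThermcert1TrialGeneratorSockets.lean`
(p615465: the proved row admissibility `isThermalRowState_of_supportingMu` ∕ `exists_supportingMu_mem_band`, hub-tc-therm-crit-2 ∕ plan-1),
`Theorems/TcThermcert1VertexDefs.lean` (p615964: `stWord`, `eebWord`, `bogWord`, `CertDatum`, `.lagr`, `.RectCert`, `.LagrAffine`,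
`LagrAffineAll`, `VertexCoverBoxB10`, `TrialGeneratorCertificateBoxB10`) — with the two LANDED stubs fed in from the tree:
S1 `Vertex.stub_trialGeneratorHook` (p614740) and S3 `Vertex.stub_lagr_affine` (p616377). The only change to §5 is that the two
dot-notation lemmas on `CertDatum` are declared with their absolute names in the structure's namespace (so `d.re_trialWord_le_lagr`,
`d.lagr_le_of_rectCert` keep working).

## Contents (everything PROVED)

* `CertDatum.re_trialWord_le_lagr` — on a thermal row state at `(10; 0; U; 7/8; μ₀)` the frozen-dual Lagrangian dominates the objective
  (stationarity rows vanish, EEB and Bogoliubov rows are `≥ 0` with multipliers `≥ 0`);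
* `le_of_affine_of_endpoints` — a function affine on a segment and `≤ c` at both ends is `≤ c` on the segment;
* `CertDatum.lagr_le_of_rectCert` — THE CELL (CORNER) RULE: an affine `L_d` certified `≤ c` at the four corners of `[U₁,U₂] × [μ₁,μ₂]` is
  `≤ c` on the cell (the `T > 0` transfer of `HubbardTTPrimeWindowCertificateConvexComb` ∕
  `Transport.BoxCertificate.le_affine_sub_sum_abs_of_forall_boxVertices`);
* `certificateBox_of_vertexCover` — `LagrAffineAll → VertexCoverBoxB10 → TrialGeneratorCertificateBoxB10` (the opener's K2 STUB 2 statement);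
* `box_of_stubs` — `TrialGeneratorHook → TrialGeneratorCertificateBoxB10 → ∀ U ∈ [79/10, 147/10], ObsThermalStiffnessSeqCeilingAtBeta 0 U (7/8) 10 (9/71)`;
* `ThermalStiffnessCeilingBoxb10_le_9o71_of` — `TrialGeneratorHook → LagrAffineAll → VertexCoverBoxB10 →` the crux decl BY NAME;
* **`ThermalStiffnessCeilingBoxb10_le_9o71_of_vertexCover : VertexCoverBoxB10 → Summit.Ventures.CertifiedManyBodySolver.Theses.TcThermcert1.ThermalStiffnessCeilingBoxb10_le_9o71`**
  — S1 and S3 taken from the tree: the crux K2 IS the single finite certificate statement S4.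

References: DLS1978 §2 eqs. (22′), (27), (28); FawziFawziScalet2024 Thm. 3.1; ArakiMoriya2003 Thm. 12.11; WangEtAl2024 §III; Han2020Bootstrap §2.
-/

noncomputable section

namespace Summit.Ventures.CertifiedManyBodySolver.Theorems.TcThermcert1.Vertex

open Filter Topology Matrix Finset
open Literature.MathematicalPhysics.QuantumLattice
open Literature.MathematicalPhysics.QuantumLattice.ThermodynamicLimit
open Literature.MathematicalPhysics.QuantumFieldTheory
open Literature.MathematicalPhysics.StatisticalMechanics
open Literature.Probability.LatticeModels
open Summit.Ventures.CertifiedManyBodySolver.Observables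
open Summit.Ventures.CertifiedManyBodySolver.Theorems.TcThermcert1
open Summit.Ventures.CertifiedManyBodySolver.Theses.TcThermcert1
open scoped ComplexConjugate ComplexOrder

/-! ## §1 Bookkeeping: the Lagrangian dominates the objective on row states; the cell (corner) rule -/

/-- Bookkeeping: on a thermal row state at `(10; 0; U; 7/8; μ₀)` the frozen-dual Lagrangian dominates the objective
(stationarity rows vanish, EEB and Bogoliubov rows are `≥ 0`, their multipliers `≥ 0`). [cite: WangEtAl2024, §III] -/
theorem CertDatum.re_trialWord_le_lagr (d : CertDatum) {U μ₀ : ℝ} {ω : InfVolFermionState 2}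
    (hω : IsThermalRowState 10 0 U (7 / 8) μ₀ ω) :
    (ω.expect (box 2 (3 * d.r + 2)) (trialWord 0 U d.r d.a)).re ≤ d.lagr U μ₀ ω := by
  obtain ⟨_, _, hrows, hbog⟩ := hω
  have hst : (d.st.map fun ρ => (ρ.y * ω.expect ρ.Λ' (stWord 0 U μ₀ ρ.hΛ ρ.A)).re).sum = 0 := by
    refine List.sum_eq_zero ?_
    intro x hx
    obtain ⟨ρ, _, rfl⟩ := List.mem_map.mp hx
    have h0 : ω.expect ρ.Λ' (stWord 0 U μ₀ ρ.hΛ ρ.A) = 0 := (hrows ρ.Λ ρ.Λ' ρ.hΛ ρ.h8 ρ.A).1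
    simp [h0]
  have heeb : 0 ≤ (d.eeb.map fun ρ => ρ.y * (ω.expect ρ.Λ' (eebWord 10 0 U μ₀ ρ.hΛ ρ.A ρ.s ρ.q)).re).sum := by
    refine List.sum_nonneg ?_
    intro x hx
    obtain ⟨ρ, _, rfl⟩ := List.mem_map.mp hx
    exact mul_nonneg ρ.hy ((hrows ρ.Λ ρ.Λ' ρ.hΛ ρ.h8 ρ.A).2 ρ.s ρ.q ρ.hsq)
  have hbg : 0 ≤ (d.bog.map fun ρ => ρ.y * (ω.expect ρ.Λ' (bogWord 10 0 U ρ.hΛ ρ.A ρ.C)).re).sum := by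
    refine List.sum_nonneg ?_
    intro x hx
    obtain ⟨ρ, _, rfl⟩ := List.mem_map.mp hx
    exact mul_nonneg ρ.hy (hbog ρ.Λ ρ.Λ' ρ.hΛ ρ.h8 ρ.A ρ.C ρ.hAN ρ.hAS ρ.hCN ρ.hCS)
  unfold CertDatum.lagr
  linarith

/-- One-dimensional frozen-dual rule: a function affine along a segment and `≤ c` at both ends is `≤ c` on the segment. [folklore] -/
theorem le_of_affine_of_endpoints {g : ℝ → ℝ} (hg : ∀ a b θ : ℝ, g ((1 - θ) * a + θ * b) = (1 - θ) * g a + θ * g b)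
    {a b x c : ℝ} (ha : g a ≤ c) (hb : g b ≤ c) (hax : a ≤ x) (hxb : x ≤ b) : g x ≤ c := by
  rcases eq_or_lt_of_le (hax.trans hxb) with hab | hab
  · have hx : x = a := le_antisymm (hxb.trans_eq hab.symm) hax
    rw [hx]; exact ha
  · set θ : ℝ := (x - a) / (b - a) with hθ_def
    have hden : 0 < b - a := by linarith
    have hθ0 : 0 ≤ θ := div_nonneg (by linarith) hden.le
    have hθ1 : θ ≤ 1 := by rw [hθ_def, div_le_one hden]; linarith
    have hxeq : x = (1 - θ) * a + θ * b := by
      have : θ * (b - a) = x - a := by rw [hθ_def]; field_simp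
      linarith [this]
    rw [hxeq, hg a b θ]
    nlinarith [ha, hb, hθ0, hθ1]

/-- **The cell (corner) rule** (two-step edge interpolation): an affine `L_d` certified `≤ c` at the four corners of `[U₁,U₂] × [μ₁,μ₂]`
is `≤ c` at every point of the cell — the `T > 0` transfer of `HubbardTTPrimeWindowCertificateConvexComb` ∕
`Transport.BoxCertificate.le_affine_sub_sum_abs_of_forall_boxVertices`. [cite: WangEtAl2024, §III] -/
theorem CertDatum.lagr_le_of_rectCert (d : CertDatum) (haff : d.LagrAffine) {U₁ U₂ μ₁ μ₂ c U μ₀ : ℝ}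
    (hcert : d.RectCert U₁ U₂ μ₁ μ₂ c) (hU₁ : U₁ ≤ U) (hU₂ : U ≤ U₂) (hμ₁ : μ₁ ≤ μ₀) (hμ₂ : μ₀ ≤ μ₂)
    {ω : InfVolFermionState 2} (hti : ω.IsTranslationInvariant) (hρ : ω.density = 7 / 8) :
    d.lagr U μ₀ ω ≤ c := by
  obtain ⟨h₁₁, h₁₂, h₂₁, h₂₂⟩ := hcert ω hti hρ
  -- horizontal affinity at a fixed `μ`, vertical affinity at a fixed `U`
  have hH : ∀ μ : ℝ, ∀ a b θ : ℝ, d.lagr ((1 - θ) * a + θ * b) μ ω = (1 - θ) * d.lagr a μ ω + θ * d.lagr b μ ω := by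
    intro μ a b θ
    have h := haff a μ b μ θ ω
    rwa [show (1 - θ) * μ + θ * μ = μ by ring] at h
  have hV : ∀ u : ℝ, ∀ a b θ : ℝ, d.lagr u ((1 - θ) * a + θ * b) ω = (1 - θ) * d.lagr u a ω + θ * d.lagr u b ω := by
    intro u a b θ
    have h := haff u a u b θ ω
    rwa [show (1 - θ) * u + θ * u = u by ring] at h
  have hlo : d.lagr U μ₁ ω ≤ c :=
    le_of_affine_of_endpoints (g := fun u => d.lagr u μ₁ ω) (hH μ₁) h₁₁ h₂₁ hU₁ hU₂
  have hhi : d.lagr U μ₂ ω ≤ c :=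
    le_of_affine_of_endpoints (g := fun u => d.lagr u μ₂ ω) (hH μ₂) h₁₂ h₂₂ hU₁ hU₂
  exact le_of_affine_of_endpoints (g := fun m => d.lagr U m ω) (hV U) hlo hhi hμ₁ hμ₂

/-! ## §2 Composition: S3 + S4 ⇒ the opener's STUB 2; S1 + STUB 2 ⇒ the box leaf; hence the crux from S4 alone -/

/-- **S3 + S4 ⇒ the opener's STUB 2** `TrialGeneratorCertificateBoxB10` (line «vertex» refines the birth skeleton: its XL stub becomes a
consequence of the bookkeeping stub and ONE finite certificate object). [cite: WangEtAl2024, §III] -/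
theorem certificateBox_of_vertexCover (haff : LagrAffineAll) (hcov : VertexCoverBoxB10) : TrialGeneratorCertificateBoxB10 := by
  intro U hU hU' μ₀ hb hs
  obtain ⟨S, hS, hcert⟩ := hcov
  obtain ⟨c, hc, h₁, h₂, h₃, h₄⟩ := hS U μ₀ hU hU' hb hs
  obtain ⟨d, hd⟩ := hcert c hc
  refine ⟨d.r, d.a, d.ha, fun ω hω => ?_⟩
  have hdom := d.re_trialWord_le_lagr hω
  have hcell := d.lagr_le_of_rectCert (haff d) hd h₁ h₂ h₃ h₄ hω.1 hω.2.1
  have h971 : (((9 / 71 : ℚ) : ℚ) : ℝ) = 9 / 71 := by push_cast; norm_num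
  rw [h971]
  linarith

/-- The box leaf from the hook and the opener's STUB 2 statement, through the PROVED row admissibility
(`Theorems/TcThermcert1TrialGeneratorSockets.lean`; byte-copy of the opener's `box_of_stubs`, v2). [cite: DLS1978, §2 eqs. (27), (28)] -/
theorem box_of_stubs (h₁ : TrialGeneratorHook) (h₂ : TrialGeneratorCertificateBoxB10) :
    ∀ U : ℝ, 79 / 10 ≤ U → U ≤ 147 / 10 → ObsThermalStiffnessSeqCeilingAtBeta 0 U (7 / 8) 10 (9 / 71) := by
  intro U hU hU'
  have hU0 : (0 : ℝ) ≤ U := by linarith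
  obtain ⟨μ₀, hband, hsupp⟩ :=
    exists_supportingMu_mem_band (tp := 0) (U := U) (n := 7 / 8) (β := 10) hU0 (by norm_num) (by norm_num) (by norm_num)
  obtain ⟨r, a, ha, hcert⟩ := h₂ U hU hU' μ₀ hband hsupp
  refine h₁ (tp := 0) (U := U) (n := 7 / 8) (β := 10) (by norm_num) (by norm_num) (by norm_num) r a ha ?_
  intro ω Ls hLs hω
  exact hcert ω (isThermalRowState_of_supportingMu hU0 (by norm_num) (by norm_num) (by norm_num) hsupp hLs hω)

/-- Hypothesis form of the whole line: S1 → S3 → S4 → K2 (row admissibility is a theorem; the K1 antecedent of K2 is not used).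
[cite: DLS1978, §2 eqs. (27), (28)] -/
theorem ThermalStiffnessCeilingBoxb10_le_9o71_of :
    TrialGeneratorHook → LagrAffineAll → VertexCoverBoxB10 → ThermalStiffnessCeilingBoxb10_le_9o71 :=
  fun h₁ h₃ h₄ _ => box_of_stubs h₁ (certificateBox_of_vertexCover h₃ h₄)

/-- **The crux K2 from S4 alone**: with S1 (`Vertex.stub_trialGeneratorHook`, p614740) and S3 (`Vertex.stub_lagr_affine`, p616377) LANDED,
the route decl `Summit.Ventures.CertifiedManyBodySolver.Theses.TcThermcert1.ThermalStiffnessCeilingBoxb10_le_9o71` (item stmt-Ventures-26382)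
follows from the single finite certificate statement `VertexCoverBoxB10` — CONDITIONAL on it; nothing discharges it here.
[cite: WangEtAl2024, §III] -/
theorem ThermalStiffnessCeilingBoxb10_le_9o71_of_vertexCover (h₄ : VertexCoverBoxB10) :
    ThermalStiffnessCeilingBoxb10_le_9o71 :=
  ThermalStiffnessCeilingBoxb10_le_9o71_of stub_trialGeneratorHook stub_lagr_affine h₄

end Summit.Ventures.CertifiedManyBodySolver.Theorems.TcThermcert1.Vertex

end
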